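import Literature.AnabelianGeometry.EtaleTheta.Discharge.Sec2Cor219iiiHeartPrelims
import HarnessLib

/-!
# [EtTh] Cor. 2.19 (iii), tower form — (b2) LEVEL COMPATIBILITY of the level-wise Δ_P-hearts (roadmap M2), GENERIC, part 1:
# the quadratic law `f(c_n) = e^{n(n−1)/2}·f(c₁)^n` and ODD-LEVEL VANISHING `red_M ∘ conjRoot (σ^M) f = red_M ∘ f` (proof-only)

S. Mochizuki, *The étale theta function and its Frobenioid-theoretic manifestations*, Publ. RIMS **45** (2009) [EtTh],
§2, Cor. 2.19 (iii), PRIMS PDF p. 65 («by taking a compatible system of members of the above collections of classes»,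
l. 36 of p. 65 in the PRIMS render); Prop. 1.1 /
p. 12 («`Δ^Θ_X` is a central extension»); Prop. 1.4 (ii), p. 22 (the translation law of the theta function: translating by
`m` periods changes `Θ̈` by a factor QUADRATIC in `m`) [cite: MochizukiEtTh2009, Cor 2.19(iii) p.65].

Cell `abc-iut`, seat abc-iut-f-142 (gen 6), K-L6 row «COR219III-M1b», slice (b2) = roadmap M2 (abc-iut-L6-lead §F v1.19cp /
abc-iut-L1-t6 gen 5 01:44:20Z + 02:41:31Z split: L1-t6 holds FILE 1a p487040 / FILE 1b p488563 / FILE 2; this file and its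
sequel `Sec2Cor219iiiLevelCompatOfHearts` give the GENERIC level-compatibility clause (b2) of abc-iut-C-hgal-2's
`cor219_iii_of_hearts` (p482618, l.82–110) that FILE 2 consumes BY NAME).  PROOF-ONLY: no definition, no instance,
no notation, no new named fact; GENERIC over every §1 setting `D`, every `E`, every `X̲̲`-choice `C`, every tower `τ`;
abc-iut-L2-t8's `conjRoot` / `rootCocycles`, abc-iut-L2-d1's `rootCocycle_apply`, this lineage's `Sec2Cor219iiiHeartPrelims`
(V1 `conjRoot_coe_eq_toTheta_comm_mul`, R3 `apply_mul_of_aug_eq_one`, `toTheta_comm_mem_DeltaTheta`) consumed BY NAME,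
nothing restated.

WHAT IS SHOWN.  The (b2) clause reads «`red_M ∘ conjRoot (x M′) f₀ = red_M ∘ conjRoot (x M) f₀` on ALL of `Π^tp_Ÿ̲̲` for
`M ∣ M′`», where FILE 2 takes `x M := a^{m_M}` with `m_M` the exponent produced by the level-`M` heart
(`heart_of_dense_of_zpowers`, p477834).  This part supplies:
* §0 `CyclotomeTower.exists_two_dvd_mem` — every cyclotome tower has an EVEN level (`cofinal` at `n = 2`): there is no
  «odd-level tower»; every tower-level statement meets even `M` (recorded because the row's bookkeeping spoke of
  odd-level towers: the parity split of p487040 bears on every tower).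
* §1 the shadow of Prop. 1.4 (ii): for a root cocycle `f`, a GEOMETRIC `σ ∈ Π^tp_X̲̲` and an ARBITRARY (possibly arithmetic)
  `k ∈ Π^tp_Ÿ̲̲`, `conjRoot σ f k = f(c₁) · f(k)` with `c₁ := σ⁻¹kσk⁻¹ ∈ Δ_P` (`conjRoot_eq_apply_comm_mul`); the iterated
  commutators `c_n := σ^{-n} k σ^{n} k⁻¹` satisfy `c_{n+1} = (σ⁻¹ c_n σ)·c₁`; the commutator character `θ[σ⁻¹; ·]` is
  multiplicative on geometric elements (`toTheta_conj_comm_mul`, centrality of `Δ_Θ` under `θ(Ker aug)`), hence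
  `θ[σ⁻¹; c_n] = e^n` with `e := θ[σ⁻¹; c₁] ∈ l·Δ_Θ` (`toTheta_comm_pow_comm`) and
  **`f(c_n) = e^{n(n−1)/2} · f(c₁)^n`** (`coe_apply_pow_comm`) — quadratic in `n`.
* §2 ODD-LEVEL VANISHING: for `M` odd, `M(M−1)/2 = M·((M−1)/2)`, so `f(c_M) = (e^{(M−1)/2} f(c₁))^M` dies in `μ_M`
  (`red_apply_pow_comm_eq_one_of_odd`), i.e. **`red_M ∘ conjRoot (σ^M) f = red_M ∘ f` on `Π^tp_Ÿ̲̲`**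
  (`red_conjRoot_pow_eq_of_odd`), and `red_M ∘ conjRoot (a^{m′}) f = red_M ∘ conjRoot (a^m) f` whenever `m ≡ m′ (mod M)`
  (`red_conjRoot_zpow_eq_of_modEq`, via the action law `conjRoot_mul_apply`).  `M(M−1)/2 ≡ 0 (mod M)` is EXACTLY the
  parity condition (residue `M/2` at even `M`) — the same parity wall as p487040, on the level-compatibility side.
The sequel assembles (b2) from the level-wise hearts (exponent congruence from hearts at one point + this vanishing).

HONEST FRAMING: unconditional statements about OUR typed objects over an arbitrary §1 setting; nothing of [EtTh]
(refereed) is asserted beyond what is proved; no side is taken on [IUTchIII] Cor. 3.12 or on any author; typed ≠ proved;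
nothing here asserts abc proved or refuted.
-/

noncomputable section

namespace Literature.AnabelianGeometry.EtaleTheta

open Literature.AnabelianGeometry.SemiGraphs
open scoped IsMulCommutative

/-! ## §0. Every cyclotome tower has an EVEN level (cofinality) -/

namespace ThetaSetting.CyclotomeTower

variable {p : ℕ} [Fact p.Prime] {D : ThetaSetting p} {l : ℕ} {Es : Set ℕ+}

/-- **Every cyclotome tower has an even level**: the level set `E` of a `CyclotomeTower` is cofinal in `(ℕ≥1, ∣)`
(field `cofinal`, the typed form of «`E` cofinal», Cor. 2.19 (ii)), so some `M ∈ E` is divisible by `2`.  Consequently no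
tower has an odd level set, and every tower-level statement meets even levels. [cite: MochizukiEtTh2009, Cor 2.19 (ii) p.64] -/
theorem exists_two_dvd_mem (τ : D.CyclotomeTower l Es) : ∃ M ∈ Es, (2 : ℕ+) ∣ M := τ.cofinal 2

end ThetaSetting.CyclotomeTower

/-! ## §1. Iterated commutators with a geometric element: the quadratic law `f(c_n) = e^{n(n−1)/2} · f(c₁)^n` -/

namespace ThetaSetting

variable {p : ℕ} [Fact p.Prime] (D : ThetaSetting p)

/-- The iterated commutators `c_n := (σ^n)⁻¹ k σ^n k⁻¹` of a GEOMETRIC `σ ∈ Π^tp_X` (`aug σ = 1`) with an ARBITRARY `k ∈ Π^tp_X`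
are geometric. [cite: MochizukiEtTh2009, Prop 1.1 p.12] -/
theorem aug_pow_comm_eq_one (σ k : D.PiTemp) (hσ : D.aug.toMonoidHom σ = 1) (n : ℕ) :
    D.aug.toMonoidHom ((σ ^ n)⁻¹ * k * σ ^ n * k⁻¹) = 1 := by
  simp only [map_mul, map_inv, map_pow, hσ, one_pow, inv_one, one_mul, mul_one, mul_inv_cancel]

/-- **The commutator character `θ[σ⁻¹; ·] := θ(σ⁻¹ · σ ·⁻¹)` is multiplicative on geometric elements** (`σ, x, y ∈ Ker aug`):
`θ[σ⁻¹; xy] = θ[σ⁻¹; x] · θ[σ⁻¹; y]` — `σ⁻¹(xy)σ(xy)⁻¹ = [σ⁻¹;x] · x[σ⁻¹;y]x⁻¹` and `θ[σ⁻¹;y] ∈ Δ_Θ` is centralised by `θx`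
(`ker_thetaToEll_central`: `Δ^Θ_X` is a central extension). [cite: MochizukiEtTh2009, Prop 1.1 p.12] -/
theorem toTheta_conj_comm_mul (σ x y : D.PiTemp) (hσ : D.aug.toMonoidHom σ = 1) (hx : D.aug.toMonoidHom x = 1)
    (hy : D.aug.toMonoidHom y = 1) :
    D.toTheta (σ⁻¹ * (x * y) * σ * (x * y)⁻¹) = D.toTheta (σ⁻¹ * x * σ * x⁻¹) * D.toTheta (σ⁻¹ * y * σ * y⁻¹) := by
  have hσinv : D.aug.toMonoidHom σ⁻¹ = 1 := by rw [map_inv, hσ, inv_one]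
  have hyΔ : D.toTheta (σ⁻¹ * y * σ * y⁻¹) ∈ D.DeltaTheta := by
    simpa [inv_inv] using D.toTheta_comm_mem_DeltaTheta hσinv hy
  have hcen := D.ker_thetaToEll_central _ hyΔ (D.toTheta x) ⟨x, (MonoidHom.mem_ker).2 hx, rfl⟩
  have hgrp : σ⁻¹ * (x * y) * σ * (x * y)⁻¹ = (σ⁻¹ * x * σ * x⁻¹) * (x * (σ⁻¹ * y * σ * y⁻¹) * x⁻¹) := by group
  have h2 : D.toTheta (x * (σ⁻¹ * y * σ * y⁻¹) * x⁻¹) = D.toTheta (σ⁻¹ * y * σ * y⁻¹) := by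
    rw [map_mul, map_mul, map_inv, ← hcen, mul_inv_cancel_right]
  rw [hgrp, map_mul, h2]

/-- `θ[σ⁻¹; σ⁻¹cσ] = θ[σ⁻¹; c]` for geometric `σ, c`: the commutator is conjugated by `θσ`, which centralises `Δ_Θ`.
[cite: MochizukiEtTh2009, Prop 1.1 p.12] -/
theorem toTheta_conj_comm_conj (σ c : D.PiTemp) (hσ : D.aug.toMonoidHom σ = 1) (hc : D.aug.toMonoidHom c = 1) :
    D.toTheta (σ⁻¹ * (σ⁻¹ * c * σ) * σ * (σ⁻¹ * c * σ)⁻¹) = D.toTheta (σ⁻¹ * c * σ * c⁻¹) := by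
  have hσinv : D.aug.toMonoidHom σ⁻¹ = 1 := by rw [map_inv, hσ, inv_one]
  have hcΔ : D.toTheta (σ⁻¹ * c * σ * c⁻¹) ∈ D.DeltaTheta := by
    simpa [inv_inv] using D.toTheta_comm_mem_DeltaTheta hσinv hc
  have hcen := D.ker_thetaToEll_central _ hcΔ (D.toTheta σ) ⟨σ, (MonoidHom.mem_ker).2 hσ, rfl⟩
  have hgrp : σ⁻¹ * (σ⁻¹ * c * σ) * σ * (σ⁻¹ * c * σ)⁻¹ = σ⁻¹ * (σ⁻¹ * c * σ * c⁻¹) * σ := by group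
  rw [hgrp, map_mul, map_mul, map_inv, mul_assoc, hcen, ← mul_assoc, inv_mul_cancel, one_mul]

/-- **`θ[σ⁻¹; c_n] = θ[σ⁻¹; c₁]^n`** for the iterated commutators `c_n := (σ^n)⁻¹kσ^nk⁻¹` of a geometric `σ` with an ARBITRARY
`k ∈ Π^tp_X`: from `c_{n+1} = (σ⁻¹c_nσ)·c₁` and the multiplicativity of `θ[σ⁻¹; ·]` on geometric elements (the `c_n` are
geometric even when `k` is not). [cite: MochizukiEtTh2009, Prop 1.1 p.12] -/
theorem toTheta_comm_pow_comm (σ k : D.PiTemp) (hσ : D.aug.toMonoidHom σ = 1) (n : ℕ) :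
    D.toTheta (σ⁻¹ * ((σ ^ n)⁻¹ * k * σ ^ n * k⁻¹) * σ * ((σ ^ n)⁻¹ * k * σ ^ n * k⁻¹)⁻¹) =
      D.toTheta (σ⁻¹ * (σ⁻¹ * k * σ * k⁻¹) * σ * (σ⁻¹ * k * σ * k⁻¹)⁻¹) ^ n := by
  induction n with
  | zero => simp
  | succ n ih =>
    have hcn : D.aug.toMonoidHom ((σ ^ n)⁻¹ * k * σ ^ n * k⁻¹) = 1 := D.aug_pow_comm_eq_one σ k hσ n
    have hc1 : D.aug.toMonoidHom (σ⁻¹ * k * σ * k⁻¹) = 1 := by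
      simpa using D.aug_pow_comm_eq_one σ k hσ 1
    have hx : D.aug.toMonoidHom (σ⁻¹ * ((σ ^ n)⁻¹ * k * σ ^ n * k⁻¹) * σ) = 1 := by
      rw [map_mul, map_mul, map_inv, hcn, hσ, mul_one, inv_one, one_mul]
    have hrec : (σ ^ (n + 1))⁻¹ * k * σ ^ (n + 1) * k⁻¹ =
        (σ⁻¹ * ((σ ^ n)⁻¹ * k * σ ^ n * k⁻¹) * σ) * (σ⁻¹ * k * σ * k⁻¹) := by
      rw [pow_succ]; group
    rw [hrec, D.toTheta_conj_comm_mul σ _ _ hσ hx hc1, D.toTheta_conj_comm_conj σ _ hσ hcn, ih, pow_succ]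

end ThetaSetting

namespace ThetaSetting.EtaleThetaData.DoubleUnderline

variable {p : ℕ} [Fact p.Prime] {D : ThetaSetting p} {E : D.EtaleThetaData} {l : ℕ}
  (C : E.DoubleUnderline l) {Es : Set ℕ+} (τ : D.CyclotomeTower l Es)

/-- Inside `Π^tp_X̲̲` the inverse images of `Δ_Θ` and of `l·Δ_Θ` coincide (`comap_DeltaTheta_Huu`, Prop. 2.12 (i)): an element of
`Π^tp_X̲̲` whose `θ`-image lies in `Δ_Θ` has `θ`-image in `l·Δ_Θ`. [cite: MochizukiEtTh2009, Prop 2.12 (i) p.45] -/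
theorem toTheta_mem_lDeltaTheta_of_mem_Huu {w : D.PiTemp} (hw : w ∈ C.Huu) (h : D.toTheta w ∈ D.DeltaTheta) :
    D.toTheta w ∈ D.lDeltaTheta l := by
  have h' : (⟨w, hw⟩ : C.Huu) ∈ (D.lDeltaTheta l).comap (D.toTheta.comp C.Huu.subtype) := by
    rw [← C.comap_DeltaTheta_Huu]; exact h
  exact h'

/-- `conjRoot` is an ACTION of `Π^tp_X̲̲`: `conjRoot (ρσ) f = conjRoot ρ (conjRoot σ f)` (`θ` and `MulAut.conjNormal` are
homomorphisms; the evaluation points `(ρσ)⁻¹k(ρσ) = σ⁻¹(ρ⁻¹kρ)σ` coincide). [cite: MochizukiEtTh2009, Def 2.13 p.46] -/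
theorem conjRoot_mul_apply (hC : D.Compat) (ρ σ : C.Huu) (f : C.GtpYdduu → D.DeltaTheta) (k : C.GtpYdduu) :
    C.conjRoot hC (ρ * σ) f k = C.conjRoot hC ρ (C.conjRoot hC σ f) k := by
  have hpt : (⟨_, C.conj_mem_GtpYdduu hC (ρ * σ) k⟩ : C.GtpYdduu) =
      ⟨_, C.conj_mem_GtpYdduu hC σ ⟨_, C.conj_mem_GtpYdduu hC ρ k⟩⟩ := by
    apply Subtype.ext
    change ((ρ * σ : C.Huu) : D.PiTemp)⁻¹ * k * ((ρ * σ : C.Huu) : D.PiTemp) =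
      (σ : D.PiTemp)⁻¹ * ((ρ : D.PiTemp)⁻¹ * k * ρ) * σ
    rw [Subgroup.coe_mul]; group
  change MulAut.conjNormal (D.toTheta ((ρ * σ : C.Huu) : D.PiTemp)) (f ⟨_, C.conj_mem_GtpYdduu hC (ρ * σ) k⟩) =
    MulAut.conjNormal (D.toTheta (ρ : D.PiTemp)) (MulAut.conjNormal (D.toTheta (σ : D.PiTemp))
      (f ⟨_, C.conj_mem_GtpYdduu hC σ ⟨_, C.conj_mem_GtpYdduu hC ρ k⟩⟩))
  rw [hpt, Subgroup.coe_mul, map_mul, map_mul, MulAut.mul_apply]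

/-- **The value of a GEOMETRIC conjugate at an ARBITRARY element** (V1 of `Sec2Cor219iiiHeartPrelims` without `aug k = 1`): for a
cocycle `f`, `σ ∈ Π^tp_X̲̲ ∩ Ker aug` and ANY `k ∈ Π^tp_Ÿ̲̲`, `conjRoot σ f k = f(σ⁻¹kσk⁻¹) · f(k)` — the outer conjugation by `θσ`
is trivial (`conjNormal_eq_of_aug_eq_one`), `σ⁻¹kσ = c₁·k` with `c₁ := σ⁻¹kσk⁻¹` GEOMETRIC (so it acts trivially on `Δ_Θ` in the
cocycle identity, `apply_mul_of_aug_eq_one`). [cite: MochizukiEtTh2009, Cor 2.19(iii) p.65] -/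
theorem conjRoot_eq_apply_comm_mul (hC : D.Compat) (f : contCocycles D.toTheta D.DeltaTheta C.GtpYdduu)
    (σ : C.Huu) (hσ : D.aug.toMonoidHom (σ : D.PiTemp) = 1) (k : C.GtpYdduu) :
    C.conjRoot hC σ f.1 k = f.1 ⟨_, C.conj_mul_inv_mem_GtpYdduu hC σ k⟩ * f.1 k := by
  have hcaug : D.aug.toMonoidHom (((⟨_, C.conj_mul_inv_mem_GtpYdduu hC σ k⟩ : C.GtpYdduu) : D.PiTemp)) = 1 := by
    change D.aug.toMonoidHom ((σ : D.PiTemp)⁻¹ * k * σ * (k : D.PiTemp)⁻¹) = 1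
    simpa using D.aug_pow_comm_eq_one (σ : D.PiTemp) (k : D.PiTemp) hσ 1
  have hsplit : (⟨_, C.conj_mem_GtpYdduu hC σ k⟩ : C.GtpYdduu) =
      (⟨_, C.conj_mul_inv_mem_GtpYdduu hC σ k⟩ : C.GtpYdduu) * k := by
    apply Subtype.ext
    change (σ : D.PiTemp)⁻¹ * k * σ = (σ : D.PiTemp)⁻¹ * k * σ * (k : D.PiTemp)⁻¹ * k
    rw [inv_mul_cancel_right]
  change MulAut.conjNormal (D.toTheta (σ : D.PiTemp)) (f.1 ⟨_, C.conj_mem_GtpYdduu hC σ k⟩) = _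
  rw [ThetaSetting.conjNormal_eq_of_aug_eq_one hσ, hsplit, C.apply_mul_of_aug_eq_one f _ _ hcaug]

/-- A cocycle vanishes at `1` (`f(1·1) = f(1)·f(1)`). [cite: MochizukiEtTh2009, Prop 1.3 p.21] -/
theorem cocycle_apply_one (f : contCocycles D.toTheta D.DeltaTheta C.GtpYdduu) : f.1 1 = 1 := by
  have h := C.apply_mul_of_aug_eq_one f 1 1 (by rw [Subgroup.coe_one, map_one])
  rw [one_mul] at h
  have h' : f.1 1 * f.1 1 = f.1 1 * 1 := by rw [mul_one]; exact h.symm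
  exact mul_left_cancel h'

/-- **The quadratic law `f(c_n) = e^{n(n−1)/2} · f(c₁)^n`** (in `(Π^tp_X)^Θ`; exponent written `n.choose 2`).  For a ROOT cocycle
`f`, a geometric `σ ∈ Π^tp_X̲̲`, an ARBITRARY `k ∈ Π^tp_Ÿ̲̲`, `c_n := (σ^n)⁻¹kσ^nk⁻¹` and `e := θ[σ⁻¹; c₁]`: induction on `n` via
`c_{n+1} = (σ⁻¹c_nσ)·c₁`, multiplicativity of `f` on `Δ_P` (R3), `f(σ⁻¹c_nσ) = conjRoot σ f (c_n) = θ[σ⁻¹;c_n]·f(c_n)` (V1, `c_n`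
geometric) and `θ[σ⁻¹;c_n] = e^n` (`toTheta_comm_pow_comm`); `(n+1).choose 2 = n + n.choose 2`.  This is the group-theoretic
shadow of the translation law of the theta function (Prop. 1.4 (ii): a factor quadratic in the number of periods).
[cite: MochizukiEtTh2009, Prop 1.4 (ii) p.22] -/
theorem coe_apply_pow_comm (hC : D.Compat) (h15 : Prop15iii E hC)
    {f : contCocycles D.toTheta D.DeltaTheta C.GtpYdduu} (hf : f ∈ C.rootCocycles hC)
    (σ : C.Huu) (hσ : D.aug.toMonoidHom (σ : D.PiTemp) = 1) (k : C.GtpYdduu) (n : ℕ) :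
    (f.1 ⟨_, C.conj_mul_inv_mem_GtpYdduu hC (σ ^ n) k⟩ : D.GtpTheta) =
      D.toTheta ((σ : D.PiTemp)⁻¹ * ((σ : D.PiTemp)⁻¹ * k * σ * (k : D.PiTemp)⁻¹) * σ *
          ((σ : D.PiTemp)⁻¹ * k * σ * (k : D.PiTemp)⁻¹)⁻¹) ^ (n.choose 2) *
        (f.1 ⟨_, C.conj_mul_inv_mem_GtpYdduu hC σ k⟩ : D.GtpTheta) ^ n := by
  induction n with
  | zero =>
    have hpt : (⟨_, C.conj_mul_inv_mem_GtpYdduu hC (σ ^ 0) k⟩ : C.GtpYdduu) = 1 := by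
      apply Subtype.ext
      change ((σ ^ 0 : C.Huu) : D.PiTemp)⁻¹ * k * ((σ ^ 0 : C.Huu) : D.PiTemp) * (k : D.PiTemp)⁻¹ = 1
      rw [pow_zero, Subgroup.coe_one]; group
    rw [hpt, C.cocycle_apply_one, Nat.choose_zero_succ, pow_zero, pow_zero, mul_one, Subgroup.coe_one]
  | succ n ih =>
    -- geometricity of the iterated commutator `c_n` and of `σ⁻¹ c_n σ`
    have hcn : D.aug.toMonoidHom (((⟨_, C.conj_mul_inv_mem_GtpYdduu hC (σ ^ n) k⟩ : C.GtpYdduu) : D.PiTemp)) = 1 := by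
      change D.aug.toMonoidHom (((σ ^ n : C.Huu) : D.PiTemp)⁻¹ * k * ((σ ^ n : C.Huu) : D.PiTemp) * (k : D.PiTemp)⁻¹) = 1
      rw [Subgroup.coe_pow]
      exact D.aug_pow_comm_eq_one (σ : D.PiTemp) (k : D.PiTemp) hσ n
    have hx : D.aug.toMonoidHom (((⟨_, C.conj_mem_GtpYdduu hC σ ⟨_, C.conj_mul_inv_mem_GtpYdduu hC (σ ^ n) k⟩⟩ :
        C.GtpYdduu) : D.PiTemp)) = 1 := by
      change D.aug.toMonoidHom ((σ : D.PiTemp)⁻¹ *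
        (((⟨_, C.conj_mul_inv_mem_GtpYdduu hC (σ ^ n) k⟩ : C.GtpYdduu) : D.PiTemp)) * σ) = 1
      rw [map_mul, map_mul, map_inv, hcn, hσ, mul_one, inv_one, one_mul]
    -- `c_{n+1} = (σ⁻¹ c_n σ) · c_1`
    have hpt : (⟨_, C.conj_mul_inv_mem_GtpYdduu hC (σ ^ (n + 1)) k⟩ : C.GtpYdduu) =
        (⟨_, C.conj_mem_GtpYdduu hC σ ⟨_, C.conj_mul_inv_mem_GtpYdduu hC (σ ^ n) k⟩⟩ : C.GtpYdduu) *
          ⟨_, C.conj_mul_inv_mem_GtpYdduu hC σ k⟩ := by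
      apply Subtype.ext
      change ((σ ^ (n + 1) : C.Huu) : D.PiTemp)⁻¹ * k * ((σ ^ (n + 1) : C.Huu) : D.PiTemp) * (k : D.PiTemp)⁻¹ =
        (σ : D.PiTemp)⁻¹ * (((σ ^ n : C.Huu) : D.PiTemp)⁻¹ * k * ((σ ^ n : C.Huu) : D.PiTemp) * (k : D.PiTemp)⁻¹) * σ *
          ((σ : D.PiTemp)⁻¹ * k * σ * (k : D.PiTemp)⁻¹)
      rw [Subgroup.coe_pow, Subgroup.coe_pow, pow_succ]; group
    -- `f(σ⁻¹ c_n σ) = conjRoot σ f (c_n) = θ[σ⁻¹; c_n] · f(c_n)`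
    have hconj : f.1 ⟨_, C.conj_mem_GtpYdduu hC σ ⟨_, C.conj_mul_inv_mem_GtpYdduu hC (σ ^ n) k⟩⟩ =
        C.conjRoot hC σ f.1 ⟨_, C.conj_mul_inv_mem_GtpYdduu hC (σ ^ n) k⟩ := by
      change _ = MulAut.conjNormal (D.toTheta (σ : D.PiTemp)) (f.1 ⟨_, C.conj_mem_GtpYdduu hC σ _⟩)
      rw [ThetaSetting.conjNormal_eq_of_aug_eq_one hσ]
    have hV1 := C.conjRoot_coe_eq_toTheta_comm_mul hC h15 hf σ hσ ⟨_, C.conj_mul_inv_mem_GtpYdduu hC (σ ^ n) k⟩ hcn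
    have hcomm : D.toTheta ((σ : D.PiTemp)⁻¹ * (((⟨_, C.conj_mul_inv_mem_GtpYdduu hC (σ ^ n) k⟩ : C.GtpYdduu) : D.PiTemp)) *
        σ * ((((⟨_, C.conj_mul_inv_mem_GtpYdduu hC (σ ^ n) k⟩ : C.GtpYdduu) : D.PiTemp)))⁻¹) =
        D.toTheta ((σ : D.PiTemp)⁻¹ * ((σ : D.PiTemp)⁻¹ * k * σ * (k : D.PiTemp)⁻¹) * σ *
          ((σ : D.PiTemp)⁻¹ * k * σ * (k : D.PiTemp)⁻¹)⁻¹) ^ n := by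
      change D.toTheta ((σ : D.PiTemp)⁻¹ * (((σ ^ n : C.Huu) : D.PiTemp)⁻¹ * k * ((σ ^ n : C.Huu) : D.PiTemp) *
        (k : D.PiTemp)⁻¹) * σ * (((σ ^ n : C.Huu) : D.PiTemp)⁻¹ * k * ((σ ^ n : C.Huu) : D.PiTemp) * (k : D.PiTemp)⁻¹)⁻¹) = _
      rw [Subgroup.coe_pow]
      exact D.toTheta_comm_pow_comm (σ : D.PiTemp) (k : D.PiTemp) hσ n
    rw [hpt, C.apply_mul_of_aug_eq_one f _ _ hx, Subgroup.coe_mul, hconj, hV1, hcomm, ih, Nat.choose_succ_succ,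
      Nat.choose_one_right, pow_add, pow_succ]
    group

/-! ## §2. Odd-level vanishing: `red_M ∘ conjRoot (σ^M) f = red_M ∘ f` on `Π^tp_Ÿ̲̲` (and the square variant) -/

/-- **Odd-level vanishing.**  For `M ∈ E` ODD, a root cocycle `f`, a geometric `σ ∈ Π^tp_X̲̲` and ANY `k ∈ Π^tp_Ÿ̲̲`:
`red_M (f(c_M)) = 1` where `c_M := (σ^M)⁻¹kσ^Mk⁻¹` — by §1, `f(c_M) = e^{M(M−1)/2} f(c₁)^M = (e^{(M−1)/2} f(c₁))^M` with
`e = θ[σ⁻¹;c₁] ∈ l·Δ_Θ` (`toTheta_mem_lDeltaTheta_of_mem_Huu`), an `M`-th power in `l·Δ_Θ`, and `μ_M` has exponent `M`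
(`card_MuN`).  `M(M−1)/2 ≡ 0 (mod M)` is EXACTLY the parity condition: at even `M` the residue is `M/2`.
[cite: MochizukiEtTh2009, Cor 2.19(iii) p.65] -/
theorem red_apply_pow_comm_eq_one_of_odd (hC : D.Compat) (h15 : Prop15iii E hC)
    {f : contCocycles D.toTheta D.DeltaTheta C.GtpYdduu} (hf : f ∈ C.rootCocycles hC)
    (σ : C.Huu) (hσ : D.aug.toMonoidHom (σ : D.PiTemp) = 1) (k : C.GtpYdduu) (M : Es)
    (hodd : ¬ 2 ∣ ((M : ℕ+) : ℕ)) :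
    (τ.mod M).red ⟨(f.1 ⟨_, C.conj_mul_inv_mem_GtpYdduu hC (σ ^ ((M : ℕ+) : ℕ)) k⟩ : D.GtpTheta), hf.1 _⟩ = 1 := by
  -- `M = 2q + 1`, `M choose 2 = M · q`
  obtain ⟨q, hq⟩ : ∃ q : ℕ, ((M : ℕ+) : ℕ) = 2 * q + 1 := ⟨((M : ℕ+) : ℕ) / 2, by omega⟩
  have hch : ((M : ℕ+) : ℕ).choose 2 = ((M : ℕ+) : ℕ) * q := by
    rw [hq, Nat.choose_two_right, Nat.add_sub_cancel, show (2 * q + 1) * (2 * q) = (2 * q + 1) * q * 2 by ring,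
      Nat.mul_div_cancel _ two_pos]
  -- the commutator `e = θ[σ⁻¹; c_1]` lies in `l·Δ_Θ`, and commutes with `f(c_1)`
  have hc1 : D.aug.toMonoidHom (((⟨_, C.conj_mul_inv_mem_GtpYdduu hC σ k⟩ : C.GtpYdduu) : D.PiTemp)) = 1 := by
    change D.aug.toMonoidHom ((σ : D.PiTemp)⁻¹ * k * σ * (k : D.PiTemp)⁻¹) = 1
    simpa using D.aug_pow_comm_eq_one (σ : D.PiTemp) (k : D.PiTemp) hσ 1
  have heΔ : D.toTheta ((σ : D.PiTemp)⁻¹ * ((σ : D.PiTemp)⁻¹ * k * σ * (k : D.PiTemp)⁻¹) * σ *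
      ((σ : D.PiTemp)⁻¹ * k * σ * (k : D.PiTemp)⁻¹)⁻¹) ∈ D.DeltaTheta :=
    C.toTheta_conj_mul_inv_mem_DeltaTheta σ hσ ⟨_, C.conj_mul_inv_mem_GtpYdduu hC σ k⟩ hc1
  have hkH : (k : D.PiTemp) ∈ C.Huu := (Subgroup.mem_inf.1 k.2).2
  have hc1H : (σ : D.PiTemp)⁻¹ * k * σ * (k : D.PiTemp)⁻¹ ∈ C.Huu :=
    C.Huu.mul_mem (C.Huu.mul_mem (C.Huu.mul_mem (C.Huu.inv_mem σ.2) hkH) σ.2) (C.Huu.inv_mem hkH)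
  have hwH : (σ : D.PiTemp)⁻¹ * ((σ : D.PiTemp)⁻¹ * k * σ * (k : D.PiTemp)⁻¹) * σ *
      ((σ : D.PiTemp)⁻¹ * k * σ * (k : D.PiTemp)⁻¹)⁻¹ ∈ C.Huu :=
    C.Huu.mul_mem (C.Huu.mul_mem (C.Huu.mul_mem (C.Huu.inv_mem σ.2) hc1H) σ.2) (C.Huu.inv_mem hc1H)
  have heΛ := C.toTheta_mem_lDeltaTheta_of_mem_Huu hwH heΔ
  have hcomm : Commute (D.toTheta ((σ : D.PiTemp)⁻¹ * ((σ : D.PiTemp)⁻¹ * k * σ * (k : D.PiTemp)⁻¹) * σ *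
      ((σ : D.PiTemp)⁻¹ * k * σ * (k : D.PiTemp)⁻¹)⁻¹)) (f.1 ⟨_, C.conj_mul_inv_mem_GtpYdduu hC σ k⟩ : D.GtpTheta) :=
    D.ker_thetaToEll_comm _ heΔ _ (f.1 _).2
  -- `f(c_M) = (e^q · f(c_1))^M`
  have hval : (f.1 ⟨_, C.conj_mul_inv_mem_GtpYdduu hC (σ ^ ((M : ℕ+) : ℕ)) k⟩ : D.GtpTheta) =
      (D.toTheta ((σ : D.PiTemp)⁻¹ * ((σ : D.PiTemp)⁻¹ * k * σ * (k : D.PiTemp)⁻¹) * σ *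
          ((σ : D.PiTemp)⁻¹ * k * σ * (k : D.PiTemp)⁻¹)⁻¹) ^ q *
        (f.1 ⟨_, C.conj_mul_inv_mem_GtpYdduu hC σ k⟩ : D.GtpTheta)) ^ ((M : ℕ+) : ℕ) := by
    rw [C.coe_apply_pow_comm hC h15 hf σ hσ k, hch, mul_comm, pow_mul, (hcomm.pow_left q).mul_pow]
  have hpow : (⟨D.toTheta ((σ : D.PiTemp)⁻¹ * ((σ : D.PiTemp)⁻¹ * k * σ * (k : D.PiTemp)⁻¹) * σ *
          ((σ : D.PiTemp)⁻¹ * k * σ * (k : D.PiTemp)⁻¹)⁻¹) ^ q * (f.1 ⟨_, C.conj_mul_inv_mem_GtpYdduu hC σ k⟩ : D.GtpTheta),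
        (D.lDeltaTheta l).mul_mem ((D.lDeltaTheta l).pow_mem heΛ q) (hf.1 _)⟩ : D.lDeltaTheta l) ^ ((M : ℕ+) : ℕ) =
      ⟨(f.1 ⟨_, C.conj_mul_inv_mem_GtpYdduu hC (σ ^ ((M : ℕ+) : ℕ)) k⟩ : D.GtpTheta), hf.1 _⟩ :=
    Subtype.ext (by rw [Subgroup.coe_pow]; exact hval.symm)
  rw [← hpow, map_pow]
  have hcard := pow_card_eq_one (G := MuN p (M : ℕ+))
    (x := (τ.mod M).red ⟨D.toTheta ((σ : D.PiTemp)⁻¹ * ((σ : D.PiTemp)⁻¹ * k * σ * (k : D.PiTemp)⁻¹) * σ *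
          ((σ : D.PiTemp)⁻¹ * k * σ * (k : D.PiTemp)⁻¹)⁻¹) ^ q * (f.1 ⟨_, C.conj_mul_inv_mem_GtpYdduu hC σ k⟩ : D.GtpTheta),
        (D.lDeltaTheta l).mul_mem ((D.lDeltaTheta l).pow_mem heΛ q) (hf.1 _)⟩)
  rwa [card_MuN] at hcard

/-- **`red_M ∘ conjRoot (σ^M) f = red_M ∘ f` on ALL of `Π^tp_Ÿ̲̲`** for `M ∈ E` odd, `f` a root cocycle and `σ ∈ Π^tp_X̲̲` geometric:
`conjRoot (σ^M) f k = f(c_M)·f(k)` (`conjRoot_eq_apply_comm_mul`) and `red_M f(c_M) = 1` (odd-level vanishing).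
[cite: MochizukiEtTh2009, Cor 2.19(iii) p.65] -/
theorem red_conjRoot_pow_eq_of_odd (hC : D.Compat) (h15 : Prop15iii E hC)
    {f : contCocycles D.toTheta D.DeltaTheta C.GtpYdduu} (hf : f ∈ C.rootCocycles hC)
    (σ : C.Huu) (hσ : D.aug.toMonoidHom (σ : D.PiTemp) = 1) (k : C.GtpYdduu) (M : Es)
    (hodd : ¬ 2 ∣ ((M : ℕ+) : ℕ)) :
    (τ.mod M).red ⟨(C.conjRoot hC (σ ^ ((M : ℕ+) : ℕ)) f.1 k : D.GtpTheta),
        (D.lDeltaTheta_normal l).conj_mem _ (hf.1 _) _⟩ =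
      (τ.mod M).red ⟨(f.1 k : D.GtpTheta), hf.1 _⟩ := by
  have hσM : D.aug.toMonoidHom ((σ ^ ((M : ℕ+) : ℕ) : C.Huu) : D.PiTemp) = 1 := by
    rw [Subgroup.coe_pow, map_pow, hσ, one_pow]
  have hsplit : (⟨(C.conjRoot hC (σ ^ ((M : ℕ+) : ℕ)) f.1 k : D.GtpTheta),
      (D.lDeltaTheta_normal l).conj_mem _ (hf.1 _) _⟩ : D.lDeltaTheta l) =
      ⟨(f.1 ⟨_, C.conj_mul_inv_mem_GtpYdduu hC (σ ^ ((M : ℕ+) : ℕ)) k⟩ : D.GtpTheta), hf.1 _⟩ *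
        ⟨(f.1 k : D.GtpTheta), hf.1 _⟩ := by
    apply Subtype.ext
    change ((C.conjRoot hC (σ ^ ((M : ℕ+) : ℕ)) f.1 k : D.DeltaTheta) : D.GtpTheta) =
      (f.1 ⟨_, C.conj_mul_inv_mem_GtpYdduu hC (σ ^ ((M : ℕ+) : ℕ)) k⟩ : D.GtpTheta) * (f.1 k : D.GtpTheta)
    rw [C.conjRoot_eq_apply_comm_mul hC f _ hσM k, Subgroup.coe_mul]
  rw [hsplit, map_mul (τ.mod M).red, C.red_apply_pow_comm_eq_one_of_odd τ hC h15 hf σ hσ k M hodd, one_mul]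

/-- **Congruent exponents give the same level-`M` reduction**: for `M ∈ E` odd, `a ∈ Π^tp_X̲̲` geometric, a root cocycle `f` and
`m ≡ m′ (mod M)`: `red_M (conjRoot (a^{m′}) f k) = red_M (conjRoot (a^m) f k)` for EVERY `k ∈ Π^tp_Ÿ̲̲` — write `a^{m′} = a^m (a^t)^M`,
use the action law `conjRoot_mul_apply` and `red_conjRoot_pow_eq_of_odd` for `σ := a^t` at the point `a^{-m}ka^m`.
[cite: MochizukiEtTh2009, Cor 2.19(iii) p.65] -/
theorem red_conjRoot_zpow_eq_of_modEq (hC : D.Compat) (h15 : Prop15iii E hC)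
    {f : contCocycles D.toTheta D.DeltaTheta C.GtpYdduu} (hf : f ∈ C.rootCocycles hC)
    (a : C.Huu) (ha : D.aug.toMonoidHom (a : D.PiTemp) = 1) (k : C.GtpYdduu) (M : Es)
    (hodd : ¬ 2 ∣ ((M : ℕ+) : ℕ)) {m m' : ℤ} (hmm' : m ≡ m' [ZMOD ((M : ℕ+) : ℕ)]) :
    (τ.mod M).red ⟨(C.conjRoot hC (a ^ m') f.1 k : D.GtpTheta), (D.lDeltaTheta_normal l).conj_mem _ (hf.1 _) _⟩ =
      (τ.mod M).red ⟨(C.conjRoot hC (a ^ m) f.1 k : D.GtpTheta), (D.lDeltaTheta_normal l).conj_mem _ (hf.1 _) _⟩ := by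
  obtain ⟨t, ht⟩ := (Int.modEq_iff_dvd.1 hmm')
  have hm' : m' = m + t * (((M : ℕ+) : ℕ) : ℤ) := by rw [mul_comm]; omega
  have ham : D.aug.toMonoidHom ((a ^ m : C.Huu) : D.PiTemp) = 1 := by
    rw [Subgroup.coe_zpow, map_zpow, ha, one_zpow]
  have hat : D.aug.toMonoidHom ((a ^ t : C.Huu) : D.PiTemp) = 1 := by
    rw [Subgroup.coe_zpow, map_zpow, ha, one_zpow]
  -- `conjRoot (a^{m'}) f k = conjRoot ((a^t)^M) f (a^{-m} k a^m)` and `conjRoot (a^m) f k = f (a^{-m} k a^m)`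
  have hdec : (a ^ m' : C.Huu) = a ^ m * (a ^ t) ^ ((M : ℕ+) : ℕ) := by
    rw [hm', zpow_add, zpow_mul, zpow_natCast]
  have key : C.conjRoot hC (a ^ m') f.1 k =
      C.conjRoot hC ((a ^ t) ^ ((M : ℕ+) : ℕ)) f.1 ⟨_, C.conj_mem_GtpYdduu hC (a ^ m) k⟩ := by
    rw [hdec, C.conjRoot_mul_apply hC]
    change MulAut.conjNormal (D.toTheta ((a ^ m : C.Huu) : D.PiTemp)) _ = _
    rw [ThetaSetting.conjNormal_eq_of_aug_eq_one ham]
  have key' : C.conjRoot hC (a ^ m) f.1 k = f.1 ⟨_, C.conj_mem_GtpYdduu hC (a ^ m) k⟩ := by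
    change MulAut.conjNormal (D.toTheta ((a ^ m : C.Huu) : D.PiTemp)) _ = _
    rw [ThetaSetting.conjNormal_eq_of_aug_eq_one ham]
  have e1 : (⟨(C.conjRoot hC (a ^ m') f.1 k : D.GtpTheta), (D.lDeltaTheta_normal l).conj_mem _ (hf.1 _) _⟩ :
      D.lDeltaTheta l) = ⟨(C.conjRoot hC ((a ^ t) ^ ((M : ℕ+) : ℕ)) f.1 ⟨_, C.conj_mem_GtpYdduu hC (a ^ m) k⟩ :
        D.GtpTheta), (D.lDeltaTheta_normal l).conj_mem _ (hf.1 _) _⟩ := by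
    apply Subtype.ext
    change ((C.conjRoot hC (a ^ m') f.1 k : D.DeltaTheta) : D.GtpTheta) =
      ((C.conjRoot hC ((a ^ t) ^ ((M : ℕ+) : ℕ)) f.1 ⟨_, C.conj_mem_GtpYdduu hC (a ^ m) k⟩ : D.DeltaTheta) : D.GtpTheta)
    rw [key]
  have e2 : (⟨(C.conjRoot hC (a ^ m) f.1 k : D.GtpTheta), (D.lDeltaTheta_normal l).conj_mem _ (hf.1 _) _⟩ :
      D.lDeltaTheta l) = ⟨(f.1 ⟨_, C.conj_mem_GtpYdduu hC (a ^ m) k⟩ : D.GtpTheta), hf.1 _⟩ := by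
    apply Subtype.ext
    change ((C.conjRoot hC (a ^ m) f.1 k : D.DeltaTheta) : D.GtpTheta) =
      ((f.1 ⟨_, C.conj_mem_GtpYdduu hC (a ^ m) k⟩ : D.DeltaTheta) : D.GtpTheta)
    rw [key']
  rw [e1, e2, C.red_conjRoot_pow_eq_of_odd τ hC h15 hf (a ^ t) hat _ M hodd]

end ThetaSetting.EtaleThetaData.DoubleUnderline

end Literature.AnabelianGeometry.EtaleTheta

end
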